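import Summits.Ventures.Crystal3D.Theorems.StickyWulffConstantGenericWallFloorStackLedgerLocalCount
import HarnessLib

/-!
# The count at one end ball for SEPARATED frame sets: `deg y + #(end states at y) ≤ 12`
# (crux `GenericWallFloor`, line `WallLedgerG`; forced-chain localisation of the stack ledger, brick 2)

HONEST FRAMING. Part of the venture `Summits/Ventures/Crystal3D` (cell `crystal3d-full`), helper `--supports` the
crux `GenericWallFloor` (stmt-Ventures-19480) of `route-Ventures-StickyWulffConstant`, registered line `WallLedgerG`,
open stub `stub_twoSlabAdhesion` (general fillings).  This is `card_contacts_add_endStates_le_twelve`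
(`…StackLedgerLocalCount`, non-chain pairs) with the two mirror-closed families replaced by an ABSTRACT pair of frame
sets `M₁`, `M₂` that are SEPARATED (no frame of `M₁` co-axial with a frame of `M₂`): the families were used only to
derive exactly this cross-grain non-co-axiality (`not_coaxial_of_family_stack`).  With the forced-ray structure
theorem (`…StackWalkForcedChain`: a walker of grain `(A, u)` only ever carries frames of `chainFrames z A u`) the
separated sets can be taken COUNTABLE — `chainFrames e₃ A₁ u₁` and `chainFrames (−e₃) A₂ u₂` — which is what lets
the residual-free ledger reach chain pairs whose connecting twin path is not followed by the forced rays.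

**`card_contacts_add_endStates_le_twelve_sep`**: `deg y + #ES₁ + #ES₂ ≤ 12` for end states at `y` with frames in
separated sets, inputs `DoubleStarCoaxialAt` (all frame pairs) and `CapPairCoaxial` — same mechanism: within a grain
`not_coaxial_of_two_states`, across grains the separation; then pairwise covering different closed stars and
`card_contacts_add_card_le_twelve`.

WHAT THIS IS NOT: not the stub; the inputs `ExactOnly` (C12-55), `DoubleStarCoaxialAt`, `CapPairCoaxial` remain;
F-C1 not moved.
-/

noncomputable section

namespace Summit.Ventures.Crystal3D.Theorems

open Finset
open Literature.MathematicalPhysics.StatisticalMechanics (fccStacking barlowStacking IsHaggSeq)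
open scoped InnerProductSpace

variable {X : Finset (EuclideanSpace ℝ (Fin 3))}

open scoped Classical in
/-- **`deg y + #(end states at y) ≤ 12` (separated frame sets).**  `ES₁`, `ES₂` are finite sets of walker states
AT `y` of grain 1 (vertical `z₁`, bottom entry `b₁`, every frame in `M₁`) and of grain 2 (`z₂`, `b₂ ≠ b₁`, every
frame in `M₂`), each satisfying `WalkInv`, `StackWF` and carrying the strong certificate; `y` has at most eleven
contacts; `M₁` and `M₂` are SEPARATED: no frame of `M₁` is co-axial with a frame of `M₂`.  Inputs:
`DoubleStarCoaxialAt` for all frame pairs and `CapPairCoaxial`.  (The non-chain version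
`card_contacts_add_endStates_le_twelve` derives the cross-grain non-co-axiality from mirror-closed families instead.) -/
theorem card_contacts_add_endStates_le_twelve_sep (hX : ∀ p ∈ X, ∀ q ∈ X, p ≠ q → 1 ≤ dist p q)
    (hDS : ∀ F₁ F₂ : EuclideanSpace ℝ (Fin 3) ≃ₗᵢ[ℝ] EuclideanSpace ℝ (Fin 3), DoubleStarCoaxialAt F₁ F₂)
    (hCP : CapPairCoaxial)
    (M₁ M₂ : Set (EuclideanSpace ℝ (Fin 3) ≃ₗᵢ[ℝ] EuclideanSpace ℝ (Fin 3)))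
    (hsep : ∀ F₁ ∈ M₁, ∀ F₂ ∈ M₂, ¬ ∃ (L : EuclideanSpace ℝ (Fin 3) ≃ₗᵢ[ℝ] EuclideanSpace ℝ (Fin 3))
        (s₁ s₂ : EuclideanSpace ℝ (Fin 3)) (σ σ' : ℤ → ℤ), IsHaggSeq σ ∧ IsHaggSeq σ' ∧
        F₁ '' fccStacking 1 (Real.sqrt (2 / 3)) ⊆ (fun p => L p + s₁) '' barlowStacking 1 (Real.sqrt (2 / 3)) σ ∧
        F₂ '' fccStacking 1 (Real.sqrt (2 / 3)) ⊆ (fun p => L p + s₂) '' barlowStacking 1 (Real.sqrt (2 / 3)) σ')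
    {b₁ b₂ : WalkEntry} (hbb : b₁ ≠ b₂)
    {z₁ z₂ y : EuclideanSpace ℝ (Fin 3)} (hdeg : (X.filter fun q => dist y q = 1).card ≤ 11)
    (ES₁ ES₂ : Finset (EuclideanSpace ℝ (Fin 3) × List WalkEntry))
    (h₁ : ∀ s ∈ ES₁, s.1 = y ∧ WalkInv X z₁ s ∧ StackWF z₁ s.2 ∧ s.2.getLast? = some b₁ ∧
      (∃ e rest, s.2 = e :: rest ∧ WalkCertified12 X y e) ∧ ∀ e ∈ s.2, e.frame ∈ M₁)
    (h₂ : ∀ s ∈ ES₂, s.1 = y ∧ WalkInv X z₂ s ∧ StackWF z₂ s.2 ∧ s.2.getLast? = some b₂ ∧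
      (∃ e rest, s.2 = e :: rest ∧ WalkCertified12 X y e) ∧ ∀ e ∈ s.2, e.frame ∈ M₂) :
    (X.filter fun q => dist y q = 1).card + ES₁.card + ES₂.card ≤ 12 := by
  -- shorthand for co-axiality of two frames
  let CoAx : (EuclideanSpace ℝ (Fin 3) ≃ₗᵢ[ℝ] EuclideanSpace ℝ (Fin 3)) →
      (EuclideanSpace ℝ (Fin 3) ≃ₗᵢ[ℝ] EuclideanSpace ℝ (Fin 3)) → Prop := fun F₁ F₂ =>
    ∃ (L : EuclideanSpace ℝ (Fin 3) ≃ₗᵢ[ℝ] EuclideanSpace ℝ (Fin 3))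
      (s₁ s₂ : EuclideanSpace ℝ (Fin 3)) (σ σ' : ℤ → ℤ), IsHaggSeq σ ∧ IsHaggSeq σ' ∧
      F₁ '' fccStacking 1 (Real.sqrt (2 / 3)) ⊆ (fun p => L p + s₁) '' barlowStacking 1 (Real.sqrt (2 / 3)) σ ∧
      F₂ '' fccStacking 1 (Real.sqrt (2 / 3)) ⊆ (fun p => L p + s₂) '' barlowStacking 1 (Real.sqrt (2 / 3)) σ'
  -- the key pairwise fact: different states at `y` have non-co-axial top frames
  have key : ∀ s ∈ ES₁ ∪ ES₂, ∀ s' ∈ ES₁ ∪ ES₂, s ≠ s' → ∀ e rest e' rest', s.2 = e :: rest → s'.2 = e' :: rest' →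
      ¬ CoAx e.frame e'.frame := by
    intro s hs s' hs' hne e rest e' rest' hse hse'
    rcases Finset.mem_union.1 hs with hs | hs <;> rcases Finset.mem_union.1 hs' with hs' | hs'
    · -- both of grain 1
      obtain ⟨hy, hI, hW, hlast, -, -⟩ := h₁ s hs
      obtain ⟨hy', hI', hW', hlast', -, -⟩ := h₁ s' hs'
      obtain ⟨hyX, hS, e₀, rest₀, hstk, hC⟩ := hI
      obtain ⟨-, hS', e₀', rest₀', hstk', hC'⟩ := hI'
      rw [hse] at hstk hS hW hlast; rw [hse'] at hstk' hS' hW' hlast'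
      injection hstk with he₀ _; injection hstk' with he₀' _
      subst he₀; subst he₀'
      rw [hy] at hC; rw [hy'] at hC'
      have hstne : e :: rest ≠ e' :: rest' := by
        intro h; apply hne; exact Prod.ext (by rw [hy, hy']) (by rw [hse, hse', h])
      exact not_coaxial_of_two_states hX hS hW hC hS' hW' hC' (hlast.trans hlast'.symm) hstne
    · -- grain 1 vs grain 2: the frame sets are separated
      obtain ⟨-, -, -, -, -, hfam⟩ := h₁ s hs
      obtain ⟨-, -, -, -, -, hfam'⟩ := h₂ s' hs'
      exact hsep e.frame (hfam e (by rw [hse]; simp)) e'.frame (hfam' e' (by rw [hse']; simp))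
    · -- grain 2 vs grain 1
      obtain ⟨-, -, -, -, -, hfam⟩ := h₂ s hs
      obtain ⟨-, -, -, -, -, hfam'⟩ := h₁ s' hs'
      exact fun hco => hsep e'.frame (hfam' e' (by rw [hse']; simp)) e.frame (hfam e (by rw [hse]; simp))
        (coaxial_linear_symm hco)
    · -- both of grain 2
      obtain ⟨hy, hI, hW, hlast, -, -⟩ := h₂ s hs
      obtain ⟨hy', hI', hW', hlast', -, -⟩ := h₂ s' hs'
      obtain ⟨hyX, hS, e₀, rest₀, hstk, hC⟩ := hI
      obtain ⟨-, hS', e₀', rest₀', hstk', hC'⟩ := hI'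
      rw [hse] at hstk hS hW hlast; rw [hse'] at hstk' hS' hW' hlast'
      injection hstk with he₀ _; injection hstk' with he₀' _
      subst he₀; subst he₀'
      rw [hy] at hC; rw [hy'] at hC'
      have hstne : e :: rest ≠ e' :: rest' := by
        intro h; apply hne; exact Prod.ext (by rw [hy, hy']) (by rw [hse, hse', h])
      exact not_coaxial_of_two_states hX hS hW hC hS' hW' hC' (hlast.trans hlast'.symm) hstne
  -- uniform data for a state of either grain
  have hdata : ∀ s ∈ ES₁ ∪ ES₂, s.1 = y ∧ y ∈ X ∧ ∃ e rest, s.2 = e :: rest ∧ e.dir ∈ fccSlots ∧ WalkCertified12 X y e := by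
    intro s hs
    rcases Finset.mem_union.1 hs with hs | hs
    · obtain ⟨hy, hI, -, -, ⟨e, rest, hse, hC⟩, -⟩ := h₁ s hs
      obtain ⟨hyX, hS, -⟩ := hI
      rw [hse] at hS; rw [hy] at hyX
      exact ⟨hy, hyX, e, rest, hse, hS.top.1, hC⟩
    · obtain ⟨hy, hI, -, -, ⟨e, rest, hse, hC⟩, -⟩ := h₂ s hs
      obtain ⟨hyX, hS, -⟩ := hI
      rw [hse] at hS; rw [hy] at hyX
      exact ⟨hy, hyX, e, rest, hse, hS.top.1, hC⟩
  -- the two families of states are disjoint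
  have hdisj : Disjoint ES₁ ES₂ := by
    rw [Finset.disjoint_left]
    intro s hs hs'
    obtain ⟨-, -, -, hl₁, -, -⟩ := h₁ s hs
    obtain ⟨-, -, -, hl₂, -, -⟩ := h₂ s hs'
    exact hbb (Option.some.inj (hl₁.symm.trans hl₂))
  -- the family of top pairs
  set 𝓟 := (ES₁ ∪ ES₂).image topPair with h𝓟
  have hinj : Set.InjOn topPair ↑(ES₁ ∪ ES₂) := by
    intro s hs s' hs' h
    by_contra hne
    obtain ⟨-, -, e, rest, hse, -, -⟩ := hdata s hs
    obtain ⟨-, -, e', rest', hse', -, -⟩ := hdata s' hs'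
    rw [topPair_eq hse, topPair_eq hse'] at h
    injection h with hf _
    exact key s hs s' hs' hne e rest e' rest' hse hse' (coaxial_linear_of_image_eq (by rw [hf]))
  have hcard : 𝓟.card = ES₁.card + ES₂.card := by
    rw [h𝓟, Finset.card_image_of_injOn hinj, Finset.card_union_of_disjoint hdisj]
  -- members of `𝓟` come with their state
  have hmem : ∀ p ∈ 𝓟, ∃ s ∈ ES₁ ∪ ES₂, ∃ e rest, s.2 = e :: rest ∧ e.dir ∈ fccSlots ∧ WalkCertified12 X y e ∧
      p = (e.frame, e.dir) := by
    intro p hp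
    obtain ⟨s, hs, rfl⟩ := Finset.mem_image.1 hp
    obtain ⟨-, -, e, rest, hse, hdir, hC⟩ := hdata s hs
    exact ⟨s, hs, e, rest, hse, hdir, hC, topPair_eq hse⟩
  have hyX : ∀ p ∈ 𝓟, y ∈ X := by
    intro p hp
    obtain ⟨s, hs, rfl⟩ := Finset.mem_image.1 hp
    exact (hdata s hs).2.1
  -- pairwise non-co-axiality for pairs
  have keyP : ∀ p ∈ 𝓟, ∀ p' ∈ 𝓟, p ≠ p' → ¬ CoAx p.1 p'.1 := by
    intro p hp p' hp' hne
    obtain ⟨s, hs, rfl⟩ := Finset.mem_image.1 hp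
    obtain ⟨s', hs', rfl⟩ := Finset.mem_image.1 hp'
    have hss : s ≠ s' := fun h => hne (by rw [h])
    obtain ⟨-, -, e, rest, hse, -, -⟩ := hdata s hs
    obtain ⟨-, -, e', rest', hse', -, -⟩ := hdata s' hs'
    rw [topPair_eq hse, topPair_eq hse']
    exact key s hs s' hs' hss e rest e' rest' hse hse'
  have hmain := card_contacts_add_card_le_twelve hdeg 𝓟 (fun p hp => ?_) (fun p hp => ?_) (fun p hp p' hp' hne => ?_)
    (fun p hp p' hp' hne => ?_)
  · rw [hcard] at hmain; omega
  · obtain ⟨s, hs, e, rest, hse, hdir, hC, rfl⟩ := hmem p hp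
    exact hdir
  · obtain ⟨s, hs, e, rest, hse, hdir, hC, rfl⟩ := hmem p hp
    exact star_owned_of_walkCertified hdir hC.walkCertified
  · -- different stars: equal stars would make the top lattices co-axial
    intro hEq
    have hnc := keyP p hp p' hp' hne
    obtain ⟨s, hs, e, rest, hse, hdir, hC, rfl⟩ := hmem p hp
    exact hnc (coaxial_of_starSet_eq hdir hEq)
  · -- covering: an eleventh contact off both stars would make the top lattices co-axial (the inputs)
    intro q hq hqd
    by_contra hnot
    rw [Finset.mem_union, not_or] at hnot
    have hnc := keyP p hp p' hp' hne
    have hy := hyX p hp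
    obtain ⟨s, hs, e, rest, hse, hdir, hC, rfl⟩ := hmem p hp
    obtain ⟨s', hs', e', rest', hse', hdir', hC', rfl⟩ := hmem p' hp'
    have hoff : ∀ (F : EuclideanSpace ℝ (Fin 3) ≃ₗᵢ[ℝ] EuclideanSpace ℝ (Fin 3)) (v : EuclideanSpace ℝ (Fin 3)),
        q ∉ starSet y F v → ∀ w ∈ fccSlots, ⟪w, v⟫_ℝ < 0 → q ≠ y + F w := by
      intro F v hq' w hw hneg hqw
      apply hq'
      unfold starSet
      exact Finset.mem_image.2 ⟨w, Finset.mem_filter.2 ⟨hw, hneg⟩, hqw.symm⟩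
    exact hnc (coaxial_of_pair_certified hX (hDS e.frame e'.frame) hCP hdir hdir' hy hC.eta hC'.eta hq hqd
      (hoff e.frame e.dir hnot.1) (hoff e'.frame e'.dir hnot.2))

end Summit.Ventures.Crystal3D.Theorems

end
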